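import Mathlib.Combinatorics.SimpleGraph.Walk.Counting
import Mathlib.Combinatorics.SimpleGraph.Paths
import Mathlib.Topology.Algebra.InfiniteSum.Constructions
import Mathlib.Topology.Algebra.InfiniteSum.ENNReal
import Summits.CriticalPhenomena.SAWScalingLimit.Theorems.SAWTotalPositivityBoundaryTP2Defs
import Summits.CriticalPhenomena.SAWScalingLimit.Theorems.SAWTotalPositivityBoundaryTP2InterlaceInherit
import Summits.CriticalPhenomena.SAWScalingLimit.Theorems.SAWTotalPositivityBoundaryTP2Strip3RecCornerAux
import HarnessLib

/-!
# Crux `BoundaryTP2` (stmt-CriticalPhenomena-7115), line `Sketch`: the first step of the loop of a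
disjoint pair (helper file of the tool stub `stub_strip4_recPair302`)

For a simple graph `K` on `V`, a fugacity `x` and vertices `a, t, u, v`, the *disjoint-pair
kernel* `PP_K(a→t; u→v) = Σ x^{|γ|} x^{|γ'|}` runs over the pairs of self-avoiding paths
`γ : a → t` (the *main path*) and `γ' : u → v` (the *loop*) of `K` with vertex-disjoint supports
(an unconditional double `tsum` in `ℝ≥0∞` over Mathlib's `SimpleGraph.Path`, written inline as in
the line's skeleton). Vertex deletion is Mathlib's `K - c = K.deleteEdges (K.incidenceSet c)` (same
vertex type, `c` isolated). The width-4 transfer recursions of the strip programme peel the new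
column off vertex by vertex; the pendant-vertex identities for these kernels are landed in
`…Strip4RecCornerAux` (`s4c_pair_leaf_start/end/irrel`, `s4c_pair_diag`,
`s4c_pair_reverse_right`). This file adds the identity at a vertex of ARBITRARY degree:

* **first step of the loop** (`pairSum_firstStep`, the registered helper stub): for `u ∉ {a, v}`
  and `0 ≤ x`, `PP_K(a→t; u→v) = x · Σ_{w ∼ u} PP_{K-u}(a→t; w→v)` — a disjoint pair is
  `(γ, u w · δ)` for a unique neighbour `w` of `u` and a unique disjoint pair `(γ, δ : w → v)` of
  `K - u` (the gluing is injective by `Walk.transfer` bookkeeping and its range contains every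
  pair whose main path avoids `u`; `Function.Injective.tsum_eq`, `ENNReal.tsum_sigma'`), with the
  specialisations to two and three neighbours (`pairSum_firstStep_pair/triple`, finite sums);
* the trivial loop `v → v`, which only records that the main path avoids `v` (`pairSum_nil`, a
  `pathKernelOn`).
-/

noncomputable section

namespace Summit.CriticalPhenomena.SAWScalingLimit.Theorems.BoundaryTP2

open SimpleGraph Walk
open scoped ENNReal

variable {V : Type*}

/-! ## Walk preliminaries -/

/-- `Walk.transfer` is injective. [folklore] -/
private theorem s4q_transfer_inj {G H : SimpleGraph V} {u v : V} {p q : G.Walk u v}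
    {hp : ∀ e, e ∈ p.edges → e ∈ H.edgeSet} {hq : ∀ e, e ∈ q.edges → e ∈ H.edgeSet}
    (h : p.transfer H hp = q.transfer H hq) : p = q :=
  edges_injective (by simpa only [edges_transfer] using congrArg Walk.edges h)

/-- The edges of a walk avoiding `c` survive the deletion of the vertex `c`. [folklore] -/
private theorem s4q_edges_avoid {K : SimpleGraph V} {c u v : V} (p : K.Walk u v)
    (hc : c ∉ p.support) :
    ∀ e, e ∈ p.edges → e ∈ (K.deleteEdges (K.incidenceSet c)).edgeSet := by
  -- adapted from `edges_mem_edgeSet_deleteEdges_incidenceSet` (…BoundaryTP2Avoid)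
  intro e he
  rw [edgeSet_deleteEdges]
  exact ⟨p.edges_subset_edgeSet he, fun hinc => hc (Walk.mem_support_of_mem_edges he hinc.2)⟩

/-- A walk of `K - u` issued from a vertex other than `u` avoids the isolated vertex `u`.
[folklore] -/
private theorem s4q_notMem {K : SimpleGraph V} {u y z : V}
    (p : (K.deleteEdges (K.incidenceSet u)).Walk y z) (hy : y ≠ u) : u ∉ p.support :=
  s3dom_not_mem_support (fun _ hw => (ne_of_adj_deleteEdges_incidenceSet hw).2 rfl) p hy

/-! ## Generic identities for the disjoint-pair kernel -/

open Classical in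
/-- A trivial loop `v → v` only records that the main path avoids `v`. [folklore] -/
theorem pairSum_nil (K : SimpleGraph V) (x : ℝ) (a t v : V) :
    (∑' (γ : K.Path a t) (γ' : K.Path v v),
      (if List.Disjoint γ.1.support γ'.1.support then
        ENNReal.ofReal (x ^ γ.1.length) * ENNReal.ofReal (x ^ γ'.1.length) else 0)) =
      pathKernelOn K x a t {γ | v ∉ γ.1.support} := by
  unfold pathKernelOn
  refine tsum_congr fun γ => ?_
  rw [tsum_eq_single (Path.nil : K.Path v v) fun γ' h => absurd (Path.loop_eq γ') h]
  simp only [Path.nil_coe, support_nil, List.disjoint_singleton, Walk.length_nil, pow_zero,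
    ENNReal.ofReal_one, mul_one, Set.indicator_apply, Set.mem_setOf_eq]

open Classical in
/-- The pair kernel as a single sum over the pairs. [folklore] -/
private theorem s4q_prod (K : SimpleGraph V) (x : ℝ) (a t u v : V) :
    (∑' (γ : K.Path a t) (γ' : K.Path u v),
      (if List.Disjoint γ.1.support γ'.1.support then
        ENNReal.ofReal (x ^ γ.1.length) * ENNReal.ofReal (x ^ γ'.1.length) else 0)) =
      ∑' q : K.Path a t × K.Path u v, (if List.Disjoint q.1.1.support q.2.1.support then
        ENNReal.ofReal (x ^ q.1.1.length) * ENNReal.ofReal (x ^ q.2.1.length) else 0) :=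
  (ENNReal.tsum_prod' (f := fun q : K.Path a t × K.Path u v =>
    (if List.Disjoint q.1.1.support q.2.1.support then
      ENNReal.ofReal (x ^ q.1.1.length) * ENNReal.ofReal (x ^ q.2.1.length) else 0))).symm

/-- **The first-step gluing.** For `u ≠ v`, `(w, γ, δ) ↦ (γ, u w · δ)` maps the triples
(neighbour `w` of `u`, self-avoiding `γ : a → t` and `δ : w → v` of `K - u`) injectively to
pairs of self-avoiding paths of `K`, onto the pairs whose main path avoids `u`, with the stated
supports and lengths. [folklore] -/
private theorem s4q_exists_cons {K : SimpleGraph V} {a t u v : V} (huv : u ≠ v) :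
    ∃ g : (Σ w : K.neighborSet u, (K.deleteEdges (K.incidenceSet u)).Path a t ×
        (K.deleteEdges (K.incidenceSet u)).Path w v) → K.Path a t × K.Path u v,
      Function.Injective g ∧
      (∀ q : K.Path a t × K.Path u v, u ∉ q.1.1.support → q ∈ Set.range g) ∧
      (∀ s, (g s).1.1.support = s.2.1.1.support ∧ (g s).2.1.support = u :: s.2.2.1.support ∧
        (g s).1.1.length = s.2.1.1.length ∧ (g s).2.1.length = s.2.2.1.length + 1) := by
  set K' := K.deleteEdges (K.incidenceSet u)
  have hle : K' ≤ K := deleteEdges_le _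
  refine ⟨fun s => (⟨s.2.1.1.transfer K (s3dom_edges_of_le hle _), s.2.1.2.transfer _⟩,
      ⟨Walk.cons s.1.2 (s.2.2.1.transfer K (s3dom_edges_of_le hle _)),
        (cons_isPath_iff _ _).2 ⟨s.2.2.2.transfer _, by
          rw [support_transfer]
          exact s4q_notMem s.2.2.1 (show K.Adj u _ from s.1.2).ne.symm⟩⟩), ?_, ?_, ?_⟩
  · rintro ⟨⟨w, hw⟩, γ, δ⟩ ⟨⟨w', hw'⟩, γ', δ'⟩ h
    simp only [Prod.mk.injEq, Subtype.mk.injEq, Walk.cons.injEq] at h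
    obtain ⟨h1, rfl, h2⟩ := h
    obtain rfl : γ = γ' := Subtype.ext (s4q_transfer_inj h1)
    obtain rfl : δ = δ' := Subtype.ext (s4q_transfer_inj (eq_of_heq h2))
    rfl
  · rintro ⟨γ, γ'⟩ hu
    obtain ⟨w, hw, δ, hδ⟩ := exists_eq_cons_of_ne huv γ'.1
    have hp : (Walk.cons hw δ).IsPath := hδ ▸ γ'.2
    rw [cons_isPath_iff] at hp
    refine ⟨⟨⟨w, hw⟩, ⟨γ.1.transfer K' (s4q_edges_avoid γ.1 hu), γ.2.transfer _⟩,
      ⟨δ.transfer K' (s4q_edges_avoid δ hp.2), hp.1.transfer _⟩⟩, ?_⟩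
    refine Prod.ext (Subtype.ext ?_) (Subtype.ext ?_)
    · simp only [transfer_transfer, transfer_self]
    · change Walk.cons hw ((δ.transfer K' _).transfer K _) = γ'.1
      rw [hδ, transfer_transfer, transfer_self]
  · rintro ⟨⟨w, hw⟩, γ, δ⟩
    exact ⟨support_transfer _ _, by rw [support_cons, support_transfer], length_transfer _ _,
      by rw [length_cons, length_transfer]⟩

open Classical in
/-- **First step of the loop** (registered helper stub). For `u ∉ {a, v}` and `0 ≤ x`,
`PP_K(a→t; u→v) = x · Σ_{w ∼ u} PP_{K-u}(a→t; w→v)`: reparametrise the pairs whose main path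
avoids `u` (all the disjoint ones) by the first-step gluing. [folklore] -/
theorem pairSum_firstStep {V : Type*} (K : SimpleGraph V) (x : ℝ) (hx : 0 ≤ x) {a t u v : V}
    (hua : u ≠ a) (huv : u ≠ v) :
    (∑' (γ : K.Path a t) (γ' : K.Path u v),
      (if List.Disjoint γ.1.support γ'.1.support then
        ENNReal.ofReal (x ^ γ.1.length) * ENNReal.ofReal (x ^ γ'.1.length) else 0)) =
      ENNReal.ofReal x * ∑' (w : K.neighborSet u)
        (γ : (K.deleteEdges (K.incidenceSet u)).Path a t)
        (γ' : (K.deleteEdges (K.incidenceSet u)).Path (w : V) v),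
        (if List.Disjoint γ.1.support γ'.1.support then
          ENNReal.ofReal (x ^ γ.1.length) * ENNReal.ofReal (x ^ γ'.1.length) else 0) := by
  set K' := K.deleteEdges (K.incidenceSet u)
  obtain ⟨g, hinj, hrange, hg⟩ := s4q_exists_cons (K := K) (a := a) (t := t) huv
  have hu : ∀ γ : K'.Path a t, u ∉ γ.1.support := fun γ => s4q_notMem γ.1 hua.symm
  rw [s4q_prod]
  calc (∑' q : K.Path a t × K.Path u v, (if List.Disjoint q.1.1.support q.2.1.support then
          ENNReal.ofReal (x ^ q.1.1.length) * ENNReal.ofReal (x ^ q.2.1.length) else 0))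
      = ∑' s, (if List.Disjoint (g s).1.1.support (g s).2.1.support then
          ENNReal.ofReal (x ^ (g s).1.1.length) * ENNReal.ofReal (x ^ (g s).2.1.length)
          else 0) := by
        refine (hinj.tsum_eq (f := fun q : K.Path a t × K.Path u v =>
          (if List.Disjoint q.1.1.support q.2.1.support then
            ENNReal.ofReal (x ^ q.1.1.length) * ENNReal.ofReal (x ^ q.2.1.length) else 0)) ?_).symm
        intro q hq
        rw [Function.mem_support] at hq
        exact hrange q fun huq => hq (if_neg fun hd => hd huq q.2.1.start_mem_support)
    _ = ∑' s : (Σ w : K.neighborSet u, K'.Path a t × K'.Path w v), ENNReal.ofReal x *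
          (if List.Disjoint s.2.1.1.support s.2.2.1.support then
            ENNReal.ofReal (x ^ s.2.1.1.length) * ENNReal.ofReal (x ^ s.2.2.1.length) else 0) := by
        refine tsum_congr fun s => ?_
        obtain ⟨h1, h2, h3, h4⟩ := hg s
        rw [h1, h2, h3, h4]
        by_cases hd : List.Disjoint s.2.1.1.support s.2.2.1.support
        · rw [if_pos (List.disjoint_cons_right.2 ⟨hu s.2.1, hd⟩), if_pos hd, pow_succ,
            ENNReal.ofReal_mul (pow_nonneg hx _)]
          ring
        · rw [if_neg fun h => hd (List.disjoint_cons_right.1 h).2, if_neg hd, mul_zero]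
    _ = ENNReal.ofReal x * ∑' (w : K.neighborSet u) (q : K'.Path a t × K'.Path w v),
          (if List.Disjoint q.1.1.support q.2.1.support then
            ENNReal.ofReal (x ^ q.1.1.length) * ENNReal.ofReal (x ^ q.2.1.length) else 0) := by
        rw [ENNReal.tsum_mul_left, ENNReal.tsum_sigma']
    _ = _ := by
        congr 1
        exact tsum_congr fun w => (s4q_prod K' x a t w v).symm

open Classical in
/-- The first step of the loop, for a finite neighbourhood given as a `Finset`. [folklore] -/
private theorem s4q_firstStep_finset (K : SimpleGraph V) (x : ℝ) (hx : 0 ≤ x) {a t u v : V}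
    (hua : u ≠ a) (huv : u ≠ v) (N : Finset V) (hN : K.neighborSet u = ↑N) :
    (∑' (γ : K.Path a t) (γ' : K.Path u v),
      (if List.Disjoint γ.1.support γ'.1.support then
        ENNReal.ofReal (x ^ γ.1.length) * ENNReal.ofReal (x ^ γ'.1.length) else 0)) =
      ENNReal.ofReal x * ∑ w ∈ N, ∑' (γ : (K.deleteEdges (K.incidenceSet u)).Path a t)
        (γ' : (K.deleteEdges (K.incidenceSet u)).Path w v),
        (if List.Disjoint γ.1.support γ'.1.support then
          ENNReal.ofReal (x ^ γ.1.length) * ENNReal.ofReal (x ^ γ'.1.length) else 0) := by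
  set f : V → ℝ≥0∞ := fun w => ∑' (γ : (K.deleteEdges (K.incidenceSet u)).Path a t)
      (γ' : (K.deleteEdges (K.incidenceSet u)).Path w v),
    (if List.Disjoint γ.1.support γ'.1.support then
      ENNReal.ofReal (x ^ γ.1.length) * ENNReal.ofReal (x ^ γ'.1.length) else 0) with hf
  rw [pairSum_firstStep K x hx hua huv]
  change ENNReal.ofReal x * ∑' w : K.neighborSet u, f w = ENNReal.ofReal x * ∑ w ∈ N, f w
  rw [tsum_congr_set_coe f hN, Finset.tsum_subtype' N f]

open Classical in
/-- First step of the loop at a vertex with exactly two neighbours. [folklore] -/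
theorem pairSum_firstStep_pair (K : SimpleGraph V) (x : ℝ) (hx : 0 ≤ x) {a t u v v₁ v₂ : V}
    (hua : u ≠ a) (huv : u ≠ v) (hN : ∀ w, K.Adj u w ↔ w = v₁ ∨ w = v₂)
    (h₁₂ : v₁ ≠ v₂) :
    (∑' (γ : K.Path a t) (γ' : K.Path u v),
      (if List.Disjoint γ.1.support γ'.1.support then
        ENNReal.ofReal (x ^ γ.1.length) * ENNReal.ofReal (x ^ γ'.1.length) else 0)) =
      ENNReal.ofReal x *
        ((∑' (γ : (K.deleteEdges (K.incidenceSet u)).Path a t)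
            (γ' : (K.deleteEdges (K.incidenceSet u)).Path v₁ v),
          (if List.Disjoint γ.1.support γ'.1.support then
            ENNReal.ofReal (x ^ γ.1.length) * ENNReal.ofReal (x ^ γ'.1.length) else 0)) +
        (∑' (γ : (K.deleteEdges (K.incidenceSet u)).Path a t)
            (γ' : (K.deleteEdges (K.incidenceSet u)).Path v₂ v),
          (if List.Disjoint γ.1.support γ'.1.support then
            ENNReal.ofReal (x ^ γ.1.length) * ENNReal.ofReal (x ^ γ'.1.length) else 0))) := by
  rw [s4q_firstStep_finset K x hx hua huv {v₁, v₂} (by ext w; simp [hN]),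
    Finset.sum_pair h₁₂]

open Classical in
/-- First step of the loop at a vertex with exactly three neighbours. [folklore] -/
theorem pairSum_firstStep_triple (K : SimpleGraph V) (x : ℝ) (hx : 0 ≤ x)
    {a t u v v₁ v₂ v₃ : V} (hua : u ≠ a) (huv : u ≠ v)
    (hN : ∀ w, K.Adj u w ↔ w = v₁ ∨ w = v₂ ∨ w = v₃) (h₁₂ : v₁ ≠ v₂) (h₁₃ : v₁ ≠ v₃)
    (h₂₃ : v₂ ≠ v₃) :
    (∑' (γ : K.Path a t) (γ' : K.Path u v),
      (if List.Disjoint γ.1.support γ'.1.support then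
        ENNReal.ofReal (x ^ γ.1.length) * ENNReal.ofReal (x ^ γ'.1.length) else 0)) =
      ENNReal.ofReal x *
        ((∑' (γ : (K.deleteEdges (K.incidenceSet u)).Path a t)
            (γ' : (K.deleteEdges (K.incidenceSet u)).Path v₁ v),
          (if List.Disjoint γ.1.support γ'.1.support then
            ENNReal.ofReal (x ^ γ.1.length) * ENNReal.ofReal (x ^ γ'.1.length) else 0)) +
        (∑' (γ : (K.deleteEdges (K.incidenceSet u)).Path a t)
            (γ' : (K.deleteEdges (K.incidenceSet u)).Path v₂ v),
          (if List.Disjoint γ.1.support γ'.1.support then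
            ENNReal.ofReal (x ^ γ.1.length) * ENNReal.ofReal (x ^ γ'.1.length) else 0)) +
        (∑' (γ : (K.deleteEdges (K.incidenceSet u)).Path a t)
            (γ' : (K.deleteEdges (K.incidenceSet u)).Path v₃ v),
          (if List.Disjoint γ.1.support γ'.1.support then
            ENNReal.ofReal (x ^ γ.1.length) * ENNReal.ofReal (x ^ γ'.1.length) else 0))) := by
  rw [s4q_firstStep_finset K x hx hua huv {v₁, v₂, v₃} (by ext w; simp [hN]),
    Finset.sum_insert (by simp [h₁₂, h₁₃]), Finset.sum_pair h₂₃, add_assoc]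

end Summit.CriticalPhenomena.SAWScalingLimit.Theorems.BoundaryTP2
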